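import Mathlib.LinearAlgebra.Dimension.Constructions
import Mathlib.Order.CompleteLattice.Finset
import Mathlib.LinearAlgebra.Finsupp.LinearCombination
import Mathlib.Logic.Equiv.Basic
import Literature.Computability.AlgebraicComplexity.SmallFormatRankNormalization
import HarnessLib

/-!
# Sandwiching moves and the chain lemmas 12–13 of Bläser 2003

Topic `Literature/Computability/AlgebraicComplexity`. Sixth proof file behind `SmallFormatRank.lean`
(target `blaser2003_thm14`, Bläser 2003, Thm. 14), on top of `SmallFormatRankNormalization.lean`.

## Content

* Shapes of the sandwiching matrices of §5 (p. 53): `FixesCols h v` (`v ∈ G_h(n,k)`: the first `h`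
  columns are unit vectors, so `z v` keeps its first `h` columns), `IsTopBlock q u`
  (`u ∈ G^q(n,k) = [u' 0; 0 1]`, row operations on the first `q` rows), `blockEmbed n o q A`
  (the `n × n` matrix which is `A` on the block `[o,o+q)²` and the identity elsewhere; multiplicative,
  hence invertible for invertible `A`), `swapMatrix k a b` (permutation matrix of a transposition
  of columns).
* Completing vectors to invertible matrices: `exists_basis_extends` (a linearly independent family
  is the beginning of a basis indexed by `Fin n`), `exists_linearEquiv_apply_single_eq` (an
  automorphism with prescribed first column), `toMatrix'_mul_toMatrix'_symm`.
* Dimension bounds for the shape subspaces (`finrank_topZero_le`, `le_finrank_topZero`,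
  `le_finrank_colZero`), and `disjoint_biSup_colZero`: a sum of flag-adapted subspaces
  `A_τ ⊆ Z_{o+τ}`, `A_τ ∩ L_{o+τ} = 0` meets `L_{o+T}` trivially (p. 59).
* Span helpers (`disjoint_span_image_ker`, `exists_mem_span_image_apply_eq`, `map_span_image`),
  `colMap` (a column as a linear map).
* `blaser2003_lemma12` — **Lemma 12** and `blaser2003_lemma13` — **Lemma 13** (pp. 54–56), proved
  by induction on the number `s` of matrices as printed (there: backward induction on `h`), in the
  form actually used later: all `x_l v` (resp. `u x_l v`) lie in `W_1 + ⋯ + W_t` (the printed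
  equality of spans is not needed). Lemma 13 is stated with the hypothesis
  `⟨x_1, …, x_s⟩ ∩ L_{n−1} = 0` as `Disjoint (span (range x)) L_{n−1}`; Lemmas 10 and 11 of the
  paper (bookkeeping of projections under sandwiching) are replaced by the direct decompositions
  `x_l − p(x_l) ∈ ⟨x_a | a ∈ T₁⟩`.

## References

* M. Bläser, *On the complexity of the multiplication of matrices of small formats*,
  J. Complexity 19 (2003) 43–60, §5: p. 53 (the groups `G_h`, `G^h`, `P_h`), Lemma 12, Lemma 13
  and their proofs (pp. 54–56), p. 59. [Blaser2003]
-/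

namespace Literature.Computability.AlgebraicComplexity

open Module Matrix

variable {k : Type*} [Field k]

/-! ## Shapes of the sandwiching matrices: `G_h(n,k)`, `G^h(n,k)` (Bläser 2003, §5, p. 53) -/

section Shapes

variable {n : ℕ}

/-- `v` fixes the first `h` columns: the columns `j < h` of `v` are the unit vectors `e_j`, so that
`z v` has the same first `h` columns as `z` (the part of "`v ∈ G_h(n,k)`: multiplication from the
right corresponds to column operations of the columns `h+1, …, n`" that is used; Bläser 2003,
p. 53). [cite: Blaser2003, §5 p. 53] -/
def FixesCols (h : ℕ) (v : Matrix (Fin n) (Fin n) k) : Prop :=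
  ∀ i j : Fin n, (j : ℕ) < h → v i j = if i = j then 1 else 0

/-- `u ∈ G^q(n,k)`: `u = [u' 0; 0 1]` acts by row operations on the first `q` rows only
(Bläser 2003, p. 53). [cite: Blaser2003, §5 p. 53] -/
def IsTopBlock (q : ℕ) (u : Matrix (Fin n) (Fin n) k) : Prop :=
  ∀ i j : Fin n, (q ≤ (i : ℕ) ∨ q ≤ (j : ℕ)) → u i j = if i = j then 1 else 0

/-- Right multiplication by `v ∈ G_h` does not change the first `h` columns.
[cite: Blaser2003, §5 p. 53] -/
theorem mul_apply_of_fixesCols {h : ℕ} {v : Matrix (Fin n) (Fin n) k} (hv : FixesCols h v)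
    (z : Matrix (Fin n) (Fin n) k) (i j : Fin n) (hj : (j : ℕ) < h) : (z * v) i j = z i j := by
  rw [Matrix.mul_apply]
  simp_rw [hv _ j hj]
  simp

/-- The identity fixes all columns. [cite: Blaser2003, §5 p. 53] -/
theorem fixesCols_one (h : ℕ) : FixesCols h (1 : Matrix (Fin n) (Fin n) k) :=
  fun i j _ => by rw [Matrix.one_apply]

/-- `G_{h'} ⊆ G_h` for `h ≤ h'`. [cite: Blaser2003, §5 p. 53] -/
theorem FixesCols.mono {h h' : ℕ} (hle : h ≤ h') {v : Matrix (Fin n) (Fin n) k}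
    (hv : FixesCols h' v) : FixesCols h v :=
  fun i j hj => hv i j (lt_of_lt_of_le hj hle)

/-- `G_h` is closed under products. [cite: Blaser2003, §5 p. 53] -/
theorem FixesCols.mul {h : ℕ} {v w : Matrix (Fin n) (Fin n) k} (hv : FixesCols h v)
    (hw : FixesCols h w) : FixesCols h (v * w) := by
  intro i j hj
  rw [mul_apply_of_fixesCols hw v i j hj, hv i j hj]

/-- Left multiplication by `u ∈ G^q` does not change the rows `i ≥ q`.
[cite: Blaser2003, §5 p. 53] -/
theorem topBlock_mul_apply_of_le {q : ℕ} {u : Matrix (Fin n) (Fin n) k} (hu : IsTopBlock q u)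
    (z : Matrix (Fin n) (Fin n) k) (i j : Fin n) (hi : q ≤ (i : ℕ)) : (u * z) i j = z i j := by
  rw [Matrix.mul_apply]
  simp_rw [hu i _ (Or.inl hi)]
  simp

/-- Left multiplication by `u ∈ G^q` maps the rows `i < q` to combinations of the rows `l < q`;
in particular zeros in the first `q` rows of a column are preserved. [cite: Blaser2003, §5 p. 53] -/
theorem topBlock_mul_apply_eq_zero {q : ℕ} {u : Matrix (Fin n) (Fin n) k} (hu : IsTopBlock q u)
    (z : Matrix (Fin n) (Fin n) k) (i j : Fin n) (hi : (i : ℕ) < q)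
    (hz : ∀ l : Fin n, (l : ℕ) < q → z l j = 0) : (u * z) i j = 0 := by
  rw [Matrix.mul_apply]
  refine Finset.sum_eq_zero fun l _ => ?_
  by_cases hl : (l : ℕ) < q
  · rw [hz l hl, mul_zero]
  · rw [hu i l (Or.inr (not_lt.1 hl)), if_neg, zero_mul]
    rintro rfl
    exact hl hi

/-- The identity lies in every `G^q`. [cite: Blaser2003, §5 p. 53] -/
theorem isTopBlock_one (q : ℕ) : IsTopBlock q (1 : Matrix (Fin n) (Fin n) k) :=
  fun i j _ => by rw [Matrix.one_apply]

/-- `G^q ⊆ G^{q'}` for `q ≤ q'`. [cite: Blaser2003, §5 p. 53] -/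
theorem IsTopBlock.mono {q q' : ℕ} (hle : q ≤ q') {u : Matrix (Fin n) (Fin n) k}
    (hu : IsTopBlock q u) : IsTopBlock q' u :=
  fun i j hij => hu i j (hij.imp (le_trans hle) (le_trans hle))

/-- `G^q` is closed under products. [cite: Blaser2003, §5 p. 53] -/
theorem IsTopBlock.mul {q : ℕ} {u w : Matrix (Fin n) (Fin n) k} (hu : IsTopBlock q u)
    (hw : IsTopBlock q w) : IsTopBlock q (u * w) := by
  intro i j hij
  rcases hij with hi | hj
  · rw [topBlock_mul_apply_of_le hu w i j hi, hw i j (Or.inl hi)]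
  · rw [Matrix.mul_apply]
    simp_rw [hw _ j (Or.inr hj)]
    simp [hu i j (Or.inr hj)]

end Shapes

/-! ## Block embeddings of `q × q` matrices -/

section Block

variable {n : ℕ}

/-- The index embedding of the block `[o, o+q)`. [folklore] -/
def blkEmb (o q : ℕ) (hoq : o + q ≤ n) : Fin q ↪ Fin n :=
  ⟨fun i => ⟨o + i, by omega⟩, fun i j h => Fin.ext (by simpa using congrArg Fin.val h)⟩

/-- Values of `blkEmb`. [folklore] -/
@[simp] theorem blkEmb_val (o q : ℕ) (hoq : o + q ≤ n) (i : Fin q) : ((blkEmb o q hoq i : Fin n) : ℕ) = o + i :=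
  rfl

/-- A sum over `Fin n` of a function supported in the block `[o, o+q)` is a sum over the block.
[folklore] -/
theorem sum_eq_sum_blk {M : Type*} [AddCommMonoid M] (o q : ℕ) (hoq : o + q ≤ n) (f : Fin n → M)
    (hf : ∀ l : Fin n, ¬(o ≤ (l : ℕ) ∧ (l : ℕ) < o + q) → f l = 0) :
    ∑ l, f l = ∑ l' : Fin q, f (blkEmb o q hoq l') := by
  classical
  rw [← Finset.sum_map Finset.univ (blkEmb o q hoq) f]
  refine (Finset.sum_subset (Finset.subset_univ _) fun l _ hl => hf l fun hlb => hl ?_).symm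
  refine Finset.mem_map.2 ⟨⟨l - o, by omega⟩, Finset.mem_univ _, Fin.ext ?_⟩
  simp only [blkEmb_val]
  omega

/-- The `n × n` matrix which is `A` on the block `[o, o+q) × [o, o+q)` and the identity elsewhere
(the elements of `G_h`, `G^h` of Bläser 2003, p. 53, are of this form with `o = h`, resp.
`o = 0`). [cite: Blaser2003, §5 p. 53] -/
def blockEmbed (n o q : ℕ) (A : Matrix (Fin q) (Fin q) k) : Matrix (Fin n) (Fin n) k :=
  Matrix.of fun i j =>
    if hi : o ≤ (i : ℕ) ∧ (i : ℕ) < o + q then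
      (if hj : o ≤ (j : ℕ) ∧ (j : ℕ) < o + q then A ⟨i - o, by omega⟩ ⟨j - o, by omega⟩ else 0)
    else if i = j then 1 else 0

/-- Entries of `blockEmbed` inside the block. [folklore] -/
theorem blockEmbed_blk_blk (o q : ℕ) (hoq : o + q ≤ n) (A : Matrix (Fin q) (Fin q) k)
    (i j : Fin q) : blockEmbed n o q A (blkEmb o q hoq i) (blkEmb o q hoq j) = A i j := by
  simp only [blockEmbed, Matrix.of_apply, blkEmb_val]
  rw [dif_pos (by omega), dif_pos (by omega)]
  simp only [Nat.add_sub_cancel_left, Fin.eta]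

/-- Entries of `blockEmbed` in a block row outside the block columns vanish. [folklore] -/
theorem blockEmbed_of_row_mem_col_not (o q : ℕ) (A : Matrix (Fin q) (Fin q) k)
    (i j : Fin n) (hi : o ≤ (i : ℕ) ∧ (i : ℕ) < o + q) (hj : ¬(o ≤ (j : ℕ) ∧ (j : ℕ) < o + q)) :
    blockEmbed n o q A i j = 0 := by
  simp only [blockEmbed, Matrix.of_apply]
  rw [dif_pos hi, dif_neg hj]

/-- Entries of `blockEmbed` outside the block rows are those of the identity. [folklore] -/
theorem blockEmbed_of_row_not (o q : ℕ) (A : Matrix (Fin q) (Fin q) k)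
    (i j : Fin n) (hi : ¬(o ≤ (i : ℕ) ∧ (i : ℕ) < o + q)) :
    blockEmbed n o q A i j = if i = j then 1 else 0 := by
  simp only [blockEmbed, Matrix.of_apply]
  rw [dif_neg hi]

/-- `blockEmbed` is multiplicative. [folklore] -/
theorem blockEmbed_mul (o q : ℕ) (hoq : o + q ≤ n) (A B : Matrix (Fin q) (Fin q) k) :
    blockEmbed n o q A * blockEmbed n o q B = blockEmbed n o q (A * B) := by
  ext i j
  rw [Matrix.mul_apply]
  by_cases hi : o ≤ (i : ℕ) ∧ (i : ℕ) < o + q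
  · obtain ⟨i', rfl⟩ : ∃ i' : Fin q, blkEmb o q hoq i' = i :=
      ⟨⟨i - o, by omega⟩, Fin.ext (by simp only [blkEmb_val]; omega)⟩
    rw [sum_eq_sum_blk o q hoq _ (fun l hl => by
      rw [blockEmbed_of_row_mem_col_not o q A _ l (by simp only [blkEmb_val]; omega) hl, zero_mul])]
    simp_rw [blockEmbed_blk_blk]
    by_cases hj : o ≤ (j : ℕ) ∧ (j : ℕ) < o + q
    · obtain ⟨j', rfl⟩ : ∃ j' : Fin q, blkEmb o q hoq j' = j :=
        ⟨⟨j - o, by omega⟩, Fin.ext (by simp only [blkEmb_val]; omega)⟩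
      simp_rw [blockEmbed_blk_blk]
      rw [Matrix.mul_apply]
    · rw [blockEmbed_of_row_mem_col_not o q (A * B) _ j (by simp only [blkEmb_val]; omega) hj]
      refine Finset.sum_eq_zero fun l' _ => ?_
      rw [blockEmbed_of_row_mem_col_not o q B _ j (by simp only [blkEmb_val]; omega) hj, mul_zero]
  · simp_rw [blockEmbed_of_row_not o q A i _ hi]
    simp only [ite_mul, one_mul, zero_mul, Finset.sum_ite_eq, Finset.mem_univ, if_true]
    rw [blockEmbed_of_row_not o q B i j hi, blockEmbed_of_row_not o q (A * B) i j hi]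

/-- `blockEmbed 1 = 1`. [folklore] -/
theorem blockEmbed_one (o q : ℕ) : blockEmbed n o q (1 : Matrix (Fin q) (Fin q) k) = 1 := by
  ext i j
  simp only [blockEmbed, Matrix.of_apply]
  by_cases hi : o ≤ (i : ℕ) ∧ (i : ℕ) < o + q
  · rw [dif_pos hi, Matrix.one_apply]
    by_cases hj : o ≤ (j : ℕ) ∧ (j : ℕ) < o + q
    · rw [dif_pos hj, Matrix.one_apply]
      by_cases hij : i = j
      · subst hij; simp
      · rw [if_neg hij, if_neg]
        intro h
        apply hij
        apply Fin.ext
        have := congrArg Fin.val h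
        simp only at this
        omega
    · rw [dif_neg hj, if_neg]
      rintro rfl
      exact hj hi
  · rw [dif_neg hi, Matrix.one_apply]

/-- A block embedding of an invertible matrix is invertible. [folklore] -/
theorem blockEmbed_mul_blockEmbed_eq_one (o q : ℕ) (hoq : o + q ≤ n)
    (A A' : Matrix (Fin q) (Fin q) k) (h : A * A' = 1) :
    blockEmbed n o q A * blockEmbed n o q A' = 1 := by
  rw [blockEmbed_mul o q hoq, h, blockEmbed_one]

/-- `blockEmbed 0 q A ∈ G^q`. [cite: Blaser2003, §5 p. 53] -/
theorem isTopBlock_blockEmbed (q : ℕ) (A : Matrix (Fin q) (Fin q) k) :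
    IsTopBlock q (blockEmbed n 0 q A) := by
  intro i j hij
  rcases hij with hi | hj
  · exact blockEmbed_of_row_not 0 q A i j (by omega)
  · by_cases hi : 0 ≤ (i : ℕ) ∧ (i : ℕ) < 0 + q
    · rw [blockEmbed_of_row_mem_col_not 0 q A i j hi (by omega),
        if_neg (by rintro rfl; omega)]
    · exact blockEmbed_of_row_not 0 q A i j hi

/-- `blockEmbed o q A ∈ G_o` (it fixes the first `o` columns). [cite: Blaser2003, §5 p. 53] -/
theorem fixesCols_blockEmbed (o q : ℕ) (A : Matrix (Fin q) (Fin q) k) :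
    FixesCols o (blockEmbed n o q A) := by
  intro i j hj
  by_cases hi : o ≤ (i : ℕ) ∧ (i : ℕ) < o + q
  · rw [blockEmbed_of_row_mem_col_not o q A i j hi (by omega),
      if_neg (by rintro rfl; omega)]
  · exact blockEmbed_of_row_not o q A i j hi

/-- The window `[o, o+q)` of a vector. [folklore] -/
def window (o q : ℕ) (hoq : o + q ≤ n) (c : Fin n → k) : Fin q → k := fun i => c (blkEmb o q hoq i)

omit [Field k] in
/-- Values of `window`. [folklore] -/
@[simp] theorem window_apply (o q : ℕ) (hoq : o + q ≤ n) (c : Fin n → k) (i : Fin q) :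
    window o q hoq c i = c (blkEmb o q hoq i) := rfl

/-- Action of a block embedding on a column vector, inside the block. [folklore] -/
theorem blockEmbed_mulVec_blk (o q : ℕ) (hoq : o + q ≤ n) (A : Matrix (Fin q) (Fin q) k)
    (c : Fin n → k) (i : Fin q) :
    (blockEmbed n o q A *ᵥ c) (blkEmb o q hoq i) = (A *ᵥ window o q hoq c) i := by
  simp only [Matrix.mulVec, dotProduct, window]
  rw [sum_eq_sum_blk o q hoq _ (fun l hl => by
    rw [blockEmbed_of_row_mem_col_not o q A _ l (by simp only [blkEmb_val]; omega) hl, zero_mul])]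
  simp_rw [blockEmbed_blk_blk]

/-- Action of a block embedding on a column vector, outside the block. [folklore] -/
theorem blockEmbed_mulVec_of_not (o q : ℕ) (A : Matrix (Fin q) (Fin q) k)
    (c : Fin n → k) (i : Fin n) (hi : ¬(o ≤ (i : ℕ) ∧ (i : ℕ) < o + q)) :
    (blockEmbed n o q A *ᵥ c) i = c i := by
  simp only [Matrix.mulVec, dotProduct]
  simp_rw [blockEmbed_of_row_not o q A i _ hi]
  simp

/-- Column `blkEmb j` of `z * blockEmbed A` is `z` applied to the `j`-th column of `A` placed in the
block. [folklore] -/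
theorem mul_blockEmbed_apply_blk (o q : ℕ) (hoq : o + q ≤ n) (A : Matrix (Fin q) (Fin q) k)
    (z : Matrix (Fin n) (Fin n) k) (i : Fin n) (j : Fin q) :
    (z * blockEmbed n o q A) i (blkEmb o q hoq j) = ∑ l : Fin q, z i (blkEmb o q hoq l) * A l j := by
  rw [Matrix.mul_apply]
  rw [sum_eq_sum_blk o q hoq _ (fun l hl => by
    rw [blockEmbed_of_row_not o q A l _ hl, if_neg (by rintro rfl; simp only [blkEmb_val] at hl; omega),
      mul_zero])]
  simp_rw [blockEmbed_blk_blk]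

end Block

/-! ## Permutation matrices of transpositions of columns -/

section Swap

variable {n : ℕ}

/-- The permutation matrix of the transposition `(a b)`: `z * swapMatrix a b` is `z` with the
columns `a` and `b` exchanged (Bläser 2003, p. 55: "`v'` the permutation matrix that exchanges the
`j`th column with the `(h+1)`th column"). [cite: Blaser2003, Lemma 13 (proof)] -/
def swapMatrix (k : Type*) [Field k] (a b : Fin n) : Matrix (Fin n) (Fin n) k :=
  Matrix.of fun i j => if i = Equiv.swap a b j then 1 else 0

/-- Columns of `z * swapMatrix a b`. [cite: Blaser2003, Lemma 13 (proof)] -/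
@[simp] theorem mul_swapMatrix_apply (a b : Fin n) (z : Matrix (Fin n) (Fin n) k) (i j : Fin n) :
    (z * swapMatrix k a b) i j = z i (Equiv.swap a b j) := by
  simp [swapMatrix, Matrix.mul_apply]

/-- A transposition is an involution. [cite: Blaser2003, Lemma 13 (proof)] -/
theorem swapMatrix_mul_self (a b : Fin n) : swapMatrix k a b * swapMatrix k a b = 1 := by
  ext i j
  rw [mul_swapMatrix_apply, Matrix.one_apply]
  simp only [swapMatrix, Matrix.of_apply, Equiv.swap_apply_self]

/-- A transposition of columns `≥ h` fixes the first `h` columns. [cite: Blaser2003, Lemma 13 (proof)] -/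
theorem fixesCols_swapMatrix {h : ℕ} {a b : Fin n} (ha : h ≤ (a : ℕ)) (hb : h ≤ (b : ℕ)) :
    FixesCols h (swapMatrix k a b) := by
  intro i j hj
  have hja : j ≠ a := fun h => by subst h; omega
  have hjb : j ≠ b := fun h => by subst h; omega
  simp [swapMatrix, Equiv.swap_apply_of_ne_of_ne hja hjb]

/-- A transposition of two columns other than the last one preserves `L_{n−1}` (the matrices
with only the last column non-zero): "`L_{n−1} v = L_{n−1}`". [cite: Blaser2003, Lemma 13] -/
theorem mul_swapMatrix_mem_colZero {a b : Fin n} (ha : (a : ℕ) + 1 < n) (hb : (b : ℕ) + 1 < n)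
    {z : Matrix (Fin n) (Fin n) k} (hz : z ∈ colZero k n n (n - 1)) :
    z * swapMatrix k a b ∈ colZero k n n (n - 1) := by
  intro i j hj
  rw [mul_swapMatrix_apply]
  apply hz
  by_cases hja : j = a
  · subst hja; simp; omega
  · by_cases hjb : j = b
    · subst hjb; simp; omega
    · rw [Equiv.swap_apply_of_ne_of_ne hja hjb]; exact hj

end Swap

/-! ## Completing vectors to invertible matrices -/

section Completion

/-- `Basis.sumExtend` extends the given family: on the left summand it is `v`. [folklore] -/
theorem sumExtend_inl {V ι : Type*} [AddCommGroup V] [Module k V] {v : ι → V}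
    (hs : LinearIndependent k v) (i : ι) : Basis.sumExtend hs (Sum.inl i) = v i := by
  classical
  simp only [Basis.sumExtend, Trans.trans, Basis.reindex_apply, Equiv.symm_symm, Basis.coe_extend]
  change ((Equiv.Set.sumDiffSubset (hs.linearIndepOn_id.subset_extend _)
    (Sum.inl (Equiv.ofInjective v hs.injective i)) : _) : V) = v i
  rw [Equiv.Set.sumDiffSubset_apply_inl]
  rfl

/-- Linearly independent vectors `c_0, …, c_{p−1} ∈ k^n` are the first `p` vectors of a basis of
`k^n` indexed by `Fin n` (so that the matrix with these columns can be completed to an invertible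
one — "sandwiching"). [folklore] -/
theorem exists_basis_extends {n p : ℕ} (hp : p ≤ n) (c : Fin p → (Fin n → k))
    (hc : LinearIndependent k c) :
    ∃ B : Basis (Fin n) k (Fin n → k), ∀ j : Fin p, B (Fin.castLE hp j) = c j := by
  classical
  let B₀ := Basis.sumExtend hc
  haveI : Finite (Fin p ⊕ Basis.sumExtendIndex hc) := Module.Finite.finite_basis B₀
  haveI : Finite (Basis.sumExtendIndex hc) :=
    Finite.of_injective (Sum.inr : _ → Fin p ⊕ Basis.sumExtendIndex hc) Sum.inr_injective
  haveI : Fintype (Basis.sumExtendIndex hc) := Fintype.ofFinite _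
  have hcardX : Fintype.card (Basis.sumExtendIndex hc) = n - p := by
    have h := Module.finrank_eq_card_basis B₀
    simp only [finrank_fintype_fun_eq_card, Fintype.card_fin, Fintype.card_sum] at h
    omega
  let eX : Basis.sumExtendIndex hc ≃ Fin (n - p) := Fintype.equivFinOfCardEq hcardX
  let e : Fin p ⊕ Basis.sumExtendIndex hc ≃ Fin n :=
    (Equiv.sumCongr (Equiv.refl _) eX).trans (finSumFinEquiv.trans (finCongr (by omega)))
  refine ⟨B₀.reindex e, fun j => ?_⟩
  have hej : e (Sum.inl j) = Fin.castLE hp j := by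
    apply Fin.ext
    simp [e, finSumFinEquiv_apply_left]
  rw [← hej, Basis.reindex_apply, Equiv.symm_apply_apply]
  exact sumExtend_inl hc j

/-- For a non-zero vector `c ∈ k^q` there is a linear automorphism of `k^q` sending `e_0` to `c`
(so an invertible matrix with first column `c`). [folklore] -/
theorem exists_linearEquiv_apply_single_eq {q : ℕ} (hq : 0 < q) (c : Fin q → k) (hc : c ≠ 0) :
    ∃ L : (Fin q → k) ≃ₗ[k] (Fin q → k), L (Pi.single ⟨0, hq⟩ 1) = c := by
  have hli : LinearIndependent k (fun _ : Fin 1 => c) := by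
    rw [linearIndependent_unique_iff]; exact hc
  obtain ⟨B, hB⟩ := exists_basis_extends (show 1 ≤ q from hq) (fun _ => c) hli
  refine ⟨(Pi.basisFun k (Fin q)).equiv B (Equiv.refl _), ?_⟩
  have h0 : (Pi.single ⟨0, hq⟩ 1 : Fin q → k) = Pi.basisFun k (Fin q) ⟨0, hq⟩ := by simp
  rw [h0, Basis.equiv_apply, Equiv.refl_apply]
  have : (⟨0, hq⟩ : Fin q) = Fin.castLE (show 1 ≤ q from hq) 0 := Fin.ext rfl
  rw [this, hB 0]

/-- The matrices of a linear automorphism and of its inverse are mutually inverse. [folklore] -/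
theorem toMatrix'_mul_toMatrix'_symm {q : ℕ} (L : (Fin q → k) ≃ₗ[k] (Fin q → k)) :
    LinearMap.toMatrix' L.toLinearMap * LinearMap.toMatrix' L.symm.toLinearMap = 1 := by
  rw [← LinearMap.toMatrix'_comp]; simp

/-- The matrices of a linear automorphism and of its inverse are mutually inverse. [folklore] -/
theorem toMatrix'_symm_mul_toMatrix' {q : ℕ} (L : (Fin q → k) ≃ₗ[k] (Fin q → k)) :
    LinearMap.toMatrix' L.symm.toLinearMap * LinearMap.toMatrix' L.toLinearMap = 1 := by
  rw [← LinearMap.toMatrix'_comp]; simp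

end Completion

/-! ## Dimensions of the shape subspaces -/

section Dimensions

/-- `dim {z ∈ k^{e×h} | first q rows zero} ≤ (e − q) h`. [folklore] -/
theorem finrank_topZero_le {e h q : ℕ} (hq : q ≤ e) :
    finrank k (topZero k e h q) ≤ (e - q) * h := by
  let res : Matrix (Fin e) (Fin h) k →ₗ[k] Matrix (Fin (e - q)) (Fin h) k :=
    { toFun := fun z => Matrix.of fun i j => z ⟨q + i, by omega⟩ j
      map_add' := fun x y => rfl
      map_smul' := fun a x => rfl }
  have hinj : Function.Injective (res.comp (topZero k e h q).subtype) := by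
    rw [← LinearMap.ker_eq_bot, LinearMap.ker_eq_bot']
    intro z hz
    apply Subtype.ext
    ext i j
    by_cases hi : (i : ℕ) < q
    · exact z.2 i j hi
    · have := congrFun (congrFun hz ⟨i - q, by omega⟩) j
      simp only [LinearMap.coe_comp, Submodule.coe_subtype, Function.comp_apply, res,
        LinearMap.coe_mk, AddHom.coe_mk, Matrix.of_apply, Matrix.zero_apply] at this
      have hii : (⟨q + (↑i - q), by omega⟩ : Fin e) = i := Fin.ext (by simp only; omega)
      rw [hii] at this
      rw [this]
      rfl
  have := LinearMap.finrank_le_finrank_of_injective hinj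
  rw [Module.finrank_matrix] at this
  simpa using this

/-- `(e − q) h ≤ dim {z ∈ k^{e×h} | first q rows zero}`. [folklore] -/
theorem le_finrank_topZero {e h q : ℕ} (hq : q ≤ e) :
    (e - q) * h ≤ finrank k (topZero k e h q) := by
  classical
  let ν : Fin (e - q) → Fin e := fun i => ⟨q + i, by omega⟩
  have hν : Function.Injective ν := fun i i' hh => Fin.ext (by simpa [ν] using congrArg Fin.val hh)
  have hmem : ∀ p : Fin (e - q) × Fin h, Matrix.single (ν p.1) p.2 (1 : k) ∈ topZero k e h q := by
    intro p i j hi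
    have : ν p.1 ≠ i := fun hh => by simp [← hh, ν] at hi
    exact Matrix.single_apply_of_row_ne this _ _ _
  have hli : LinearIndependent k fun p : Fin (e - q) × Fin h => Matrix.single (ν p.1) p.2 (1 : k) := by
    have h0 := (Matrix.stdBasis k (Fin e) (Fin h)).linearIndependent.comp
      (fun p : Fin (e - q) × Fin h => (ν p.1, p.2))
      (fun p p' hpq => by
        simp only [Prod.mk.injEq] at hpq
        exact Prod.ext (hν hpq.1) hpq.2)
    have hfun : (fun p : Fin (e - q) × Fin h => Matrix.single (ν p.1) p.2 (1 : k)) =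
        ⇑(Matrix.stdBasis k (Fin e) (Fin h)) ∘ fun p : Fin (e - q) × Fin h => (ν p.1, p.2) := by
      funext p
      rw [Function.comp_apply, Matrix.stdBasis_eq_single]
    rw [hfun]
    exact h0
  have hli' : LinearIndependent k fun p : Fin (e - q) × Fin h =>
      (⟨Matrix.single (ν p.1) p.2 (1 : k), hmem p⟩ : topZero k e h q) :=
    LinearIndependent.of_comp (topZero k e h q).subtype hli
  have := hli'.fintype_card_le_finrank
  simpa [Fintype.card_prod, Fintype.card_fin] using this

/-- `e (h − q) ≤ dim L_q^{e,h}`. [folklore] -/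
theorem le_finrank_colZero {e h q : ℕ} (hq : q ≤ h) :
    e * (h - q) ≤ finrank k (colZero k e h q) := by
  classical
  let ν : Fin (h - q) → Fin h := fun j => ⟨q + j, by omega⟩
  have hν : Function.Injective ν := fun j j' hh => Fin.ext (by simpa [ν] using congrArg Fin.val hh)
  have hmem : ∀ p : Fin e × Fin (h - q), Matrix.single p.1 (ν p.2) (1 : k) ∈ colZero k e h q := by
    intro p i j hj
    have : ν p.2 ≠ j := fun hh => by simp [← hh, ν] at hj
    exact Matrix.single_apply_of_col_ne _ _ this _
  have hli : LinearIndependent k fun p : Fin e × Fin (h - q) => Matrix.single p.1 (ν p.2) (1 : k) := by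
    have h0 := (Matrix.stdBasis k (Fin e) (Fin h)).linearIndependent.comp
      (fun p : Fin e × Fin (h - q) => (p.1, ν p.2))
      (fun p p' hpq => by
        simp only [Prod.mk.injEq] at hpq
        exact Prod.ext hpq.1 (hν hpq.2))
    have hfun : (fun p : Fin e × Fin (h - q) => Matrix.single p.1 (ν p.2) (1 : k)) =
        ⇑(Matrix.stdBasis k (Fin e) (Fin h)) ∘ fun p : Fin e × Fin (h - q) => (p.1, ν p.2) := by
      funext p
      rw [Function.comp_apply, Matrix.stdBasis_eq_single]
    rw [hfun]
    exact h0
  have hli' : LinearIndependent k fun p : Fin e × Fin (h - q) =>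
      (⟨Matrix.single p.1 (ν p.2) (1 : k), hmem p⟩ : colZero k e h q) :=
    LinearIndependent.of_comp (colZero k e h q).subtype hli
  have := hli'.fintype_card_le_finrank
  simpa [Fintype.card_prod, Fintype.card_fin] using this

/-- `z` has its first `q` rows zero iff `zᵀ ∈ L_q`. [folklore] -/
theorem mem_topZero_iff_transpose_mem_colZero {n q : ℕ} (z : Matrix (Fin n) (Fin n) k) :
    z ∈ topZero k n n q ↔ zᵀ ∈ colZero k n n q :=
  ⟨fun h i j hj => h j i hj, fun h i j hi => h j i hi⟩

end Dimensions

/-! ## A sum of flag-adapted subspaces meets the flag trivially -/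

section FlagSum

/-- If `A_τ ⊆ Z_{o+τ}` and `A_τ ∩ L_{o+τ} = 0` for `1 ≤ τ ≤ T`, then
`(A_1 + ⋯ + A_T) ∩ L_{o+T} = 0` (Bläser 2003, p. 59: "for the last statement, exploit the facts
that `(uW_1v) ∩ L_1 = 0`, `W_τ ⊆ Z_τ` and `W_τ ∩ L_τ = 0`"). [cite: Blaser2003, §5 p. 59] -/
theorem disjoint_biSup_colZero {e h : ℕ} :
    ∀ (T o : ℕ) (A : ℕ → Submodule k (Matrix (Fin e) (Fin h) k)),
      (∀ τ, 1 ≤ τ → τ ≤ T → A τ ≤ zSub k e h (o + τ)) →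
      (∀ τ, 1 ≤ τ → τ ≤ T → Disjoint (A τ) (colZero k e h (o + τ))) →
      Disjoint (⨆ τ ∈ Finset.Icc 1 T, A τ) (colZero k e h (o + T)) := by
  intro T
  induction T with
  | zero =>
    intro o A _ _
    simp
  | succ T ih =>
    intro o A hZ hD
    rw [Submodule.disjoint_def]
    intro z hz hzL
    -- split off `A 1`
    have hIcc : Finset.Icc 1 (T + 1) = insert 1 (Finset.Icc 2 (T + 1)) := by
      ext τ; simp; omega
    rw [hIcc, Finset.iSup_insert, Submodule.mem_sup] at hz
    obtain ⟨a, ha, z', hz', rfl⟩ := hz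
    -- the rest lies in `L_{o+1}`
    have hz'L : z' ∈ colZero k e h (o + 1) := by
      refine biSup_induction A (motive := fun y => y ∈ colZero k e h (o + 1)) hz'
        (fun τ hτ y hy => ?_) (Submodule.zero_mem _) (fun y y' hy hy' => Submodule.add_mem _ hy hy')
      obtain ⟨h2, hT⟩ := Finset.mem_Icc.1 hτ
      exact colZero_antitone e h (by omega) (zSub_le_colZero e h (o + τ) (hZ τ (by omega) hT hy))
    have haL : a ∈ colZero k e h (o + 1) := by
      have : a + z' - z' ∈ colZero k e h (o + 1) :=
        Submodule.sub_mem _ (colZero_antitone e h (by omega) hzL) hz'L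
      simpa using this
    have ha0 : a = 0 := Submodule.disjoint_def.1 (hD 1 le_rfl (by omega)) a ha haL
    subst ha0
    rw [zero_add] at hzL ⊢
    -- shift and use the induction hypothesis
    have hz'B : z' ∈ ⨆ τ ∈ Finset.Icc 1 T, A (τ + 1) := by
      refine biSup_induction A (motive := fun y => y ∈ ⨆ τ ∈ Finset.Icc 1 T, A (τ + 1)) hz'
        (fun τ hτ y hy => ?_) (Submodule.zero_mem _) (fun y y' hy hy' => Submodule.add_mem _ hy hy')
      obtain ⟨h2, hT⟩ := Finset.mem_Icc.1 hτ
      have hτ' : τ - 1 ∈ Finset.Icc 1 T := Finset.mem_Icc.2 ⟨by omega, by omega⟩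
      have : A τ = A (τ - 1 + 1) := by rw [Nat.sub_add_cancel (by omega)]
      rw [this] at hy
      exact Submodule.mem_iSup_of_mem (τ - 1) (Submodule.mem_iSup_of_mem hτ' hy)
    have hdisj := ih (o + 1) (fun τ => A (τ + 1))
      (fun τ h1 hT => by rw [Nat.add_right_comm, Nat.add_assoc]; exact hZ (τ + 1) (by omega) (by omega))
      (fun τ h1 hT => by rw [Nat.add_right_comm, Nat.add_assoc]; exact hD (τ + 1) (by omega) (by omega))
    rw [show o + 1 + T = o + (T + 1) by omega] at hdisj
    exact Submodule.disjoint_def.1 hdisj z' hz'B hzL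

end FlagSum

end Literature.Computability.AlgebraicComplexity

namespace Literature.Computability.AlgebraicComplexity

open Module Matrix

variable {k : Type*} [Field k]

/-! ## Helpers: spans of families seen through a linear map -/

section SpanHelpers

variable {M N : Type*} [AddCommGroup M] [Module k M] [AddCommGroup N] [Module k N] {ι : Type*}

/-- If the images `F x_a`, `a ∈ T`, are linearly independent, then `F` is injective on
`⟨x_a | a ∈ T⟩`: the span meets `ker F` trivially ("`W ∩ L = 0`" arguments of Bläser 2003, §§4–5,
with `F` = reading off a column). [cite: Blaser2003, Lemma 12 (proof)] -/
theorem disjoint_span_image_ker (F : M →ₗ[k] N) (x : ι → M) (T : Set ι)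
    (hli : LinearIndepOn k (F ∘ x) T) :
    Disjoint (Submodule.span k (x '' T)) (LinearMap.ker F) := by
  rw [Submodule.disjoint_def]
  intro z hz hzF
  obtain ⟨l, hl, rfl⟩ := (Finsupp.mem_span_image_iff_linearCombination k).1 hz
  have h0 : Finsupp.linearCombination k (F ∘ x) l = 0 := by
    rw [← Finsupp.apply_linearCombination]; exact hzF
  have := (linearIndepOn_iff.1 hli) l hl h0
  simp [this]

/-- If `F z` is a combination of the `F x_a`, `a ∈ T`, then some `c ∈ ⟨x_a | a ∈ T⟩` has
`F c = F z` (Bläser 2003: "`x_l u = comb(x_{≤ s'} u) + (element of L_{h+1})`").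
[cite: Blaser2003, Lemma 12 (proof)] -/
theorem exists_mem_span_image_apply_eq (F : M →ₗ[k] N) (x : ι → M) (T : Set ι) {z : M}
    (hz : F z ∈ Submodule.span k ((F ∘ x) '' T)) :
    ∃ c ∈ Submodule.span k (x '' T), F c = F z := by
  obtain ⟨l, hl, hlz⟩ := (Finsupp.mem_span_image_iff_linearCombination k).1 hz
  refine ⟨Finsupp.linearCombination k x l,
    (Finsupp.mem_span_image_iff_linearCombination k).2 ⟨l, hl, rfl⟩, ?_⟩
  rw [Finsupp.apply_linearCombination, hlz]

/-- The image of a span of a family under a linear map is spanned by the images.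
[folklore] -/
theorem map_span_image (F : M →ₗ[k] N) (x : ι → M) (T : Set ι) :
    (Submodule.span k (x '' T)).map F = Submodule.span k ((F ∘ x) '' T) := by
  rw [Submodule.map_span, ← Set.image_comp]

end SpanHelpers

/-! ## Lemma 12 -/

section Lemma12

variable {n : ℕ}

/-- Column `j` of a matrix, as a linear map. [folklore] -/
def colMap (k : Type*) [Field k] {n : ℕ} (j : Fin n) : Matrix (Fin n) (Fin n) k →ₗ[k] (Fin n → k) where
  toFun z i := z i j
  map_add' _ _ := rfl
  map_smul' _ _ := rfl

/-- Values of `colMap`. [folklore] -/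
@[simp] theorem colMap_apply (j : Fin n) (z : Matrix (Fin n) (Fin n) k) (i : Fin n) :
    colMap k j z i = z i j := rfl

/-- A matrix in `L_h` with zero `h`-th column lies in `L_{h+1}`. [cite: Blaser2003, §4 p. 48] -/
theorem mem_colZero_succ {h : ℕ} (hh : h < n) {z : Matrix (Fin n) (Fin n) k}
    (hz : z ∈ colZero k n n h) (hcol : colMap k ⟨h, hh⟩ z = 0) : z ∈ colZero k n n (h + 1) := by
  intro i j hj
  rcases lt_or_eq_of_le (Nat.lt_succ_iff.1 hj) with hlt | heq
  · exact hz i j hlt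
  · have : j = ⟨h, hh⟩ := Fin.ext heq
    subst this
    exact congrFun hcol i

/-- **Bläser 2003, Lemma 12.** Let `h ≤ n − 1`, `s ≤ n − 1 − h` and `x_1, …, x_s ∈ L_h^{n,n}`. Then
there are an invertible `v ∈ G_h(n,k)`, a number `1 ≤ t ≤ s + 1` and subspaces `W_1, …, W_t` with
`W_τ ⊆ Z_{h+τ}`, `W_τ ∩ L_{h+τ} = 0` (`τ < t`), `W_t ⊆ L_{h+t}`, `dim W_t ≤ n − 1`, such that all
`x_l v` lie in `W_1 + ⋯ + W_t` (the printed conclusion is `⟨x_1 v, …, x_s v⟩ = W_1 + ⋯ + W_t`; only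
this inclusion is used). Proof as printed (p. 54–55, backward induction on `h`, here induction on
`s`): an extra zero in position `(1, h+1)`, then either all `x_l u ∈ L_{h+1}`, or split off those
independent modulo `L_{h+1}`, project the others onto `L_{h+1}` and recurse.
[cite: Blaser2003, Lemma 12] -/
theorem blaser2003_lemma12 (s : ℕ) : ∀ (h : ℕ) (x : Fin s → Matrix (Fin n) (Fin n) k),
    s + h + 1 ≤ n → (∀ l, x l ∈ colZero k n n h) →
    ∃ (v v' : Matrix (Fin n) (Fin n) k), v * v' = 1 ∧ v' * v = 1 ∧ FixesCols h v ∧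
      ∃ (t : ℕ) (W : ℕ → Submodule k (Matrix (Fin n) (Fin n) k)), 1 ≤ t ∧ t ≤ s + 1 ∧
        (∀ τ, 1 ≤ τ → τ < t → W τ ≤ zSub k n n (h + τ) ∧ Disjoint (W τ) (colZero k n n (h + τ))) ∧
        W t ≤ colZero k n n (h + t) ∧ finrank k (W t) < n ∧
        ∀ l, x l * v ∈ ⨆ τ ∈ Finset.Icc 1 t, W τ := by
  classical
  induction s using Nat.strong_induction_on with
  | _ s ih =>
  intro h x hs hx
  have hn0 : 0 < n := by omega
  have hhn : h < n := by omega
  set K := n - h with hK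
  have hK0 : 0 < K := by omega
  have hhK : h + K ≤ n := by omega
  set i0 : Fin n := ⟨0, hn0⟩ with hi0
  set jh : Fin n := ⟨h, hhn⟩ with hjh
  -- Step 3: a non-zero `c ∈ k^{n-h}` orthogonal to the first rows (coordinates `≥ h`) of the `x_l`
  let T : (Fin K → k) →ₗ[k] (Fin s → k) :=
    { toFun := fun c l => ∑ j : Fin K, x l i0 (blkEmb h K hhK j) * c j
      map_add' := fun c c' => by
        funext l; simp [mul_add, Finset.sum_add_distrib]
      map_smul' := fun a c => by
        funext l; simp [Finset.mul_sum, mul_left_comm] }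
  have hker : LinearMap.ker T ≠ ⊥ := LinearMap.ker_ne_bot_of_finrank_lt (by
    simp only [finrank_fintype_fun_eq_card, Fintype.card_fin]; omega)
  obtain ⟨c, hcT, hc0⟩ := Submodule.exists_mem_ne_zero_of_ne_bot hker
  obtain ⟨L, hL⟩ := exists_linearEquiv_apply_single_eq hK0 c hc0
  set A := LinearMap.toMatrix' L.toLinearMap with hA
  set A' := LinearMap.toMatrix' L.symm.toLinearMap with hA'
  set u := blockEmbed n h K A with hu_def
  set u' := blockEmbed n h K A' with hu'_def
  have hu : u * u' = 1 := blockEmbed_mul_blockEmbed_eq_one h K hhK A A' (toMatrix'_mul_toMatrix'_symm L)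
  have hu' : u' * u = 1 := blockEmbed_mul_blockEmbed_eq_one h K hhK A' A (toMatrix'_symm_mul_toMatrix' L)
  have hufix : FixesCols h u := fixesCols_blockEmbed h K A
  have hAcol : ∀ l' : Fin K, A l' ⟨0, hK0⟩ = c l' := by
    intro l'
    rw [hA, LinearMap.toMatrix'_apply]
    simp only [LinearEquiv.coe_coe]
    rw [hL]
  -- the transformed matrices
  set x' : Fin s → Matrix (Fin n) (Fin n) k := fun l => x l * u with hx'
  have hx'L : ∀ l, x' l ∈ colZero k n n h := fun l i j hj => by
    simp only [hx']
    rw [mul_apply_of_fixesCols hufix (x l) i j hj]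
    exact hx l i j hj
  have hx'0 : ∀ l, x' l i0 jh = 0 := by
    intro l
    have hjh' : jh = blkEmb h K hhK ⟨0, hK0⟩ := Fin.ext (by simp [hjh])
    simp only [hx']
    rw [hjh', mul_blockEmbed_apply_blk h K hhK A (x l) i0 ⟨0, hK0⟩]
    simp_rw [hAcol]
    have := congrFun (LinearMap.mem_ker.1 hcT) l
    simpa [T] using this
  have hx'Z : ∀ l, x' l ∈ zSub k n n (h + 1) := fun l =>
    ⟨fun i j hj => hx'L l i j (by omega), fun i j hi hj => by
      have hi' : i = i0 := Fin.ext (by simp [hi0, hi])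
      have hj' : j = jh := Fin.ext (by simp [hjh]; omega)
      rw [hi', hj']; exact hx'0 l⟩
  -- the `h`-th columns
  set d : Fin s → (Fin n → k) := fun l => colMap k jh (x' l) with hd
  by_cases hall : ∀ l, x' l ∈ colZero k n n (h + 1)
  · -- all `x_l u ∈ L_{h+1}`: `t = 1`, `W_1 = ⟨x_l u⟩`
    refine ⟨u, u', hu, hu', hufix, 1, fun _ => Submodule.span k (Set.range x'), le_rfl, by omega,
      fun τ h1 h2 => by omega, ?_, ?_, fun l => ?_⟩
    · exact Submodule.span_le.2 (by rintro _ ⟨l, rfl⟩; exact hall l)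
    · exact lt_of_le_of_lt (finrank_range_le_card x') (by simp; omega)
    · exact Submodule.mem_iSup_of_mem 1 (Submodule.mem_iSup_of_mem (by simp)
        (Submodule.subset_span ⟨l, rfl⟩))
  · -- some `x_l u ∉ L_{h+1}`: split off a part independent modulo `L_{h+1}`
    push Not at hall
    obtain ⟨l₀, hl₀⟩ := hall
    obtain ⟨T₁, -, -, hspan, hli⟩ :=
      exists_linearIndepOn_extension (linearIndepOn_empty k d) (Set.empty_subset (Set.univ : Set (Fin s)))
    set T₁f : Finset (Fin s) := (Set.toFinite T₁).toFinset with hT₁f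
    have hmemT : ∀ l, l ∈ T₁f ↔ l ∈ T₁ := fun l => (Set.toFinite T₁).mem_toFinset
    have hcoeT : (T₁f : Set (Fin s)) = T₁ := by ext l; simp [hmemT]
    -- `T₁` is non-empty
    have hdl₀ : d l₀ ≠ 0 := fun h0 => hl₀ (mem_colZero_succ hhn (hx'L l₀) h0)
    have hT₁ne : T₁f.Nonempty := by
      rw [Finset.nonempty_iff_ne_empty]
      intro hemp
      have hT₁e : T₁ = ∅ := by rw [← hcoeT, hemp]; simp
      have := hspan ⟨l₀, Set.mem_univ _, rfl⟩
      rw [hT₁e, Set.image_empty, Submodule.span_empty] at this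
      exact hdl₀ (by simpa using this)
    have hs'pos : 0 < T₁f.card := Finset.card_pos.2 hT₁ne
    -- the projection killing the `x'_l`, `l ∈ T₁`, and fixing `L_{h+1}`
    have hdisj : Disjoint (Submodule.span k (x' '' T₁)) (colZero k n n (h + 1)) := by
      refine (disjoint_span_image_ker (colMap k jh) x' T₁ hli).mono_right ?_
      intro z hz
      rw [LinearMap.mem_ker]
      funext i
      exact hz i jh (by simp [hjh])
    obtain ⟨p, hpfix, hpkill, hprange⟩ := exists_proj_of_disjoint _ _ hdisj
    have hpkill' : ∀ z ∈ Submodule.span k (x' '' T₁), p z = 0 := hpkill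
    -- decomposition `x'_l = p x'_l + (element of ⟨x'_{T₁}⟩)`
    have hdecomp : ∀ l, x' l - p (x' l) ∈ Submodule.span k (x' '' T₁) := by
      intro l
      obtain ⟨cl, hcl, hFcl⟩ := exists_mem_span_image_apply_eq (colMap k jh) x' T₁
        (hspan ⟨l, Set.mem_univ _, rfl⟩)
      have hclL : cl ∈ colZero k n n h :=
        (Submodule.span_le.2 (by rintro _ ⟨a, _, rfl⟩; exact hx'L a)) hcl
      have hdiff : x' l - cl ∈ colZero k n n (h + 1) := by
        refine mem_colZero_succ hhn (Submodule.sub_mem _ (hx'L l) hclL) ?_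
        rw [map_sub, hFcl, sub_self]
      have : p (x' l) = x' l - cl := by
        have h1 : p (x' l - cl) = x' l - cl := hpfix _ hdiff
        rw [map_sub, hpkill' cl hcl, sub_zero] at h1
        exact h1
      rw [this, sub_sub_cancel]
      exact hcl
    -- recurse on the projected remaining matrices
    set s₂ := (T₁fᶜ).card with hs₂
    have hs0 : 0 < s := Fin.pos l₀
    have hs₂lt : s₂ < s := by
      rw [hs₂, Finset.card_compl, Fintype.card_fin]; omega
    let e₂ := (T₁fᶜ).equivFin
    let x₂ : Fin s₂ → Matrix (Fin n) (Fin n) k := fun i => p (x' (e₂.symm i))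
    obtain ⟨v₂, v₂', hv₂, hv₂', hv₂fix, t₂, W₂, ht₂1, ht₂s, hW₂, hW₂t, hW₂dim, hW₂mem⟩ :=
      ih s₂ hs₂lt (h + 1) x₂ (by rw [hs₂, Finset.card_compl, Fintype.card_fin]; omega)
        (fun i => hprange _)
    -- assemble
    set W : ℕ → Submodule k (Matrix (Fin n) (Fin n) k) := fun τ =>
      if τ = 1 then (Submodule.span k (x' '' T₁)).map (mulRightLin k v₂) else W₂ (τ - 1) with hW
    have hW1 : W 1 = (Submodule.span k (x' '' T₁)).map (mulRightLin k v₂) := by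
      show (if (1 : ℕ) = 1 then _ else _) = _
      rw [if_pos rfl]
    have hWsucc : ∀ τ, 1 ≤ τ → W (τ + 1) = W₂ τ := fun τ hτ => by
      show (if τ + 1 = 1 then _ else W₂ (τ + 1 - 1)) = W₂ τ
      rw [if_neg (by omega), Nat.add_sub_cancel]
    refine ⟨u * v₂, v₂' * u', ?_, ?_, hufix.mul (hv₂fix.mono (Nat.le_succ h)), t₂ + 1, W,
      by omega, by omega, ?_, ?_, ?_, ?_⟩
    · rw [Matrix.mul_assoc, ← Matrix.mul_assoc v₂, hv₂, Matrix.one_mul, hu]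
    · rw [Matrix.mul_assoc, ← Matrix.mul_assoc u', hu', Matrix.one_mul, hv₂']
    · -- the conditions for `τ < t`
      intro τ h1 h2
      rcases Nat.lt_or_ge 1 τ with hτ | hτ
      · obtain ⟨τ', rfl⟩ : ∃ τ', τ = τ' + 1 := ⟨τ - 1, by omega⟩
        rw [hWsucc τ' (by omega), show h + (τ' + 1) = h + 1 + τ' by omega]
        exact hW₂ τ' (by omega) (by omega)
      · have hτ1 : τ = 1 := by omega
        subst hτ1
        rw [hW1]
        constructor
        · -- `W 1 ⊆ Z_{h+1}`
          rintro _ ⟨z, hz, rfl⟩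
          have hzZ : z ∈ zSub k n n (h + 1) :=
            (Submodule.span_le.2 (by rintro _ ⟨a, _, rfl⟩; exact hx'Z a)) hz
          refine ⟨fun i j hj => ?_, fun i j hi hj => ?_⟩
          · rw [mulRightLin_apply, mul_apply_of_fixesCols hv₂fix z i j (by omega)]
            exact hzZ.1 i j hj
          · rw [mulRightLin_apply, mul_apply_of_fixesCols hv₂fix z i j (by omega)]
            exact hzZ.2 i j hi hj
        · -- `W 1 ∩ L_{h+1} = 0`
          rw [Submodule.disjoint_def]
          rintro _ ⟨z, hz, rfl⟩ hzL
          have hzL' : z ∈ colZero k n n (h + 1) := by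
            intro i j hj
            rw [← mul_apply_of_fixesCols hv₂fix z i j (by omega)]
            exact hzL i j hj
          have := Submodule.disjoint_def.1 hdisj z hz hzL'
          simp [this]
    · -- `W t ⊆ L_{h+t}`
      rw [hWsucc t₂ ht₂1, show h + (t₂ + 1) = h + 1 + t₂ by omega]
      exact hW₂t
    · rw [hWsucc t₂ ht₂1]; exact hW₂dim
    · -- every `x_l v` lies in the sum
      intro l
      have hsplit : x l * (u * v₂) = (x' l - p (x' l)) * v₂ + p (x' l) * v₂ := by
        rw [← Matrix.mul_assoc, Matrix.sub_mul, sub_add_cancel]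
      rw [hsplit]
      refine Submodule.add_mem _ ?_ ?_
      · refine Submodule.mem_iSup_of_mem 1 (Submodule.mem_iSup_of_mem (by simp) ?_)
        rw [hW1]
        exact ⟨_, hdecomp l, rfl⟩
      · by_cases hl : l ∈ T₁f
        · have : p (x' l) = 0 := hpkill' _ (Submodule.subset_span ⟨l, (hmemT l).1 hl, rfl⟩)
          rw [this, Matrix.zero_mul]
          exact Submodule.zero_mem _
        · have hlc : l ∈ T₁fᶜ := Finset.mem_compl.2 hl
          have hx₂l : p (x' l) = x₂ (e₂ ⟨l, hlc⟩) := by simp [x₂]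
          have hmem := hW₂mem (e₂ ⟨l, hlc⟩)
          rw [← hx₂l] at hmem
          -- shift the index
          refine biSup_induction W₂ (motive := fun y => y ∈ ⨆ τ ∈ Finset.Icc 1 (t₂ + 1), W τ) hmem
            (fun τ hτ y hy => ?_) (Submodule.zero_mem _)
            (fun y y' hy hy' => Submodule.add_mem _ hy hy')
          obtain ⟨hτ1, hτ2⟩ := Finset.mem_Icc.1 hτ
          have hτ' : τ + 1 ∈ Finset.Icc 1 (t₂ + 1) := Finset.mem_Icc.2 ⟨by omega, by omega⟩
          refine Submodule.mem_iSup_of_mem (τ + 1) (Submodule.mem_iSup_of_mem hτ' ?_)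
          rw [hWsucc τ hτ1]; exact hy

end Lemma12

/-! ## Lemma 13 -/

section Lemma13

variable {n : ℕ}

/-- The `j`-th column of `u z` is `u` applied to the `j`-th column of `z`. [folklore] -/
theorem colMap_mul (j : Fin n) (u z : Matrix (Fin n) (Fin n) k) :
    colMap k j (u * z) = u *ᵥ colMap k j z := by
  funext i
  simp [Matrix.mul_apply, Matrix.mulVec, dotProduct]

/-- Right multiplication by `v ∈ G_{h'}` does not change the columns `j < h'`. [folklore] -/
theorem colMap_mul_of_fixesCols {h' : ℕ} {v : Matrix (Fin n) (Fin n) k} (hv : FixesCols h' v)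
    (j : Fin n) (hj : (j : ℕ) < h') (z : Matrix (Fin n) (Fin n) k) :
    colMap k j (z * v) = colMap k j z := by
  funext i
  simp [mul_apply_of_fixesCols hv z i j hj]

/-- An invertible matrix acts injectively on column vectors. [folklore] -/
theorem mulVec_injective_of_mul_eq_one {u u' : Matrix (Fin n) (Fin n) k} (h : u' * u = 1) :
    Function.Injective u.mulVec := by
  intro c c' hcc'
  have := congrArg u'.mulVec hcc'
  simpa [Matrix.mulVec_mulVec, h] using this

/-- **Bläser 2003, Lemma 13.** Let `h ≤ n − 1`, `s ≤ n − 1 − h` and `x_1, …, x_s ∈ L_h^{n,n}` with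
`⟨x_1, …, x_s⟩ ∩ L_{n−1}^{n,n} = 0`. Then there are invertible matrices `u ∈ G^{s+1}(n,k)`,
`v ∈ P_h(n,k)` (here: `v` invertible, fixing the first `h` columns and preserving `L_{n−1}`), a
number `t ≤ s` and subspaces `W_1, …, W_t` with `W_τ ⊆ Z_{h+τ}`, `W_τ ∩ L_{h+τ} = 0` such that all
`u x_l v` lie in `W_1 + ⋯ + W_t` (printed: `⟨u x_1 v, …, u x_s v⟩ = W_1 + ⋯ + W_t`; only this
inclusion is used). Proof as printed (pp. 55–56): a transposition of columns bringing a non-zero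
column to position `h+1`; row operations on the first `s + 1` rows clearing the positions
`(1,h+1), …, (s+1−s', h+1)`; split off the part independent modulo `L_{h+1}`, project, recurse.
[cite: Blaser2003, Lemma 13] -/
theorem blaser2003_lemma13 (s : ℕ) : ∀ (h : ℕ) (x : Fin s → Matrix (Fin n) (Fin n) k),
    s + h + 1 ≤ n → (∀ l, x l ∈ colZero k n n h) →
    Disjoint (Submodule.span k (Set.range x)) (colZero k n n (n - 1)) →
    ∃ (u u' v v' : Matrix (Fin n) (Fin n) k), u * u' = 1 ∧ u' * u = 1 ∧ v * v' = 1 ∧ v' * v = 1 ∧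
      IsTopBlock (s + 1) u ∧ FixesCols h v ∧
      (∀ z, z ∈ colZero k n n (n - 1) → z * v ∈ colZero k n n (n - 1)) ∧
      ∃ (t : ℕ) (W : ℕ → Submodule k (Matrix (Fin n) (Fin n) k)), t ≤ s ∧
        (∀ τ, 1 ≤ τ → τ ≤ t → W τ ≤ zSub k n n (h + τ) ∧ Disjoint (W τ) (colZero k n n (h + τ))) ∧
        ∀ l, u * x l * v ∈ ⨆ τ ∈ Finset.Icc 1 t, W τ := by
  classical
  induction s using Nat.strong_induction_on with
  | _ s ih =>
  intro h x hs hx hdis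
  by_cases hzero : ∀ l, x l = 0
  · -- nothing to do: `t = 0`
    refine ⟨1, 1, 1, 1, Matrix.one_mul 1, Matrix.one_mul 1, Matrix.one_mul 1, Matrix.one_mul 1,
      isTopBlock_one _, fixesCols_one h, fun z hz => by rwa [Matrix.mul_one], 0, fun _ => ⊥,
      Nat.zero_le s, fun τ h1 h2 => by omega, fun l => ?_⟩
    rw [hzero l]; simp
  push Not at hzero
  obtain ⟨l₀, hl₀⟩ := hzero
  have hn0 : 0 < n := by omega
  have hhn : h + 1 < n := by have := Fin.pos l₀; omega
  have hs1 : 0 + (s + 1) ≤ n := by omega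
  set i0 : Fin n := ⟨0, hn0⟩ with hi0
  set jh : Fin n := ⟨h, by omega⟩ with hjh
  -- `x l₀ ∉ L_{n-1}`, hence a non-zero entry in a column `j₁` with `h ≤ j₁ < n - 1`
  have hl₀L : x l₀ ∉ colZero k n n (n - 1) := fun hL =>
    hl₀ (Submodule.disjoint_def.1 hdis _ (Submodule.subset_span ⟨l₀, rfl⟩) hL)
  obtain ⟨i₁, j₁, hj₁, hx₁⟩ : ∃ i j : Fin n, (j : ℕ) < n - 1 ∧ x l₀ i j ≠ 0 := by
    by_contra hall
    push Not at hall
    exact hl₀L fun i j hj => hall i j hj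
  have hj₁h : h ≤ (j₁ : ℕ) := by
    by_contra hlt
    exact hx₁ (hx l₀ i₁ j₁ (by omega))
  -- Step 3: the transposition of the columns `h` and `j₁`
  set v₀ := swapMatrix k jh j₁ with hv₀
  have hv₀v₀ : v₀ * v₀ = 1 := swapMatrix_mul_self jh j₁
  have hv₀fix : FixesCols h v₀ := fixesCols_swapMatrix (by simp [hjh]) hj₁h
  have hv₀L : ∀ z, z ∈ colZero k n n (n - 1) → z * v₀ ∈ colZero k n n (n - 1) :=
    fun z hz => mul_swapMatrix_mem_colZero (by simp [hjh]; omega) (by omega) hz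
  set x₀ : Fin s → Matrix (Fin n) (Fin n) k := fun l => x l * v₀ with hx₀
  have hx₀L : ∀ l, x₀ l ∈ colZero k n n h := fun l i j hj => by
    simp only [hx₀]
    rw [mul_apply_of_fixesCols hv₀fix (x l) i j hj]
    exact hx l i j hj
  set d₀ : Fin s → (Fin n → k) := fun l => colMap k jh (x₀ l) with hd₀
  have hd₀l₀ : d₀ l₀ ≠ 0 := by
    intro h0
    have := congrFun h0 i₁
    simp only [hd₀, hx₀, hv₀, colMap_apply, mul_swapMatrix_apply, Equiv.swap_apply_left,
      Pi.zero_apply] at this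
    exact hx₁ this
  -- the new family has trivial intersection with `L_{n-1}` too
  have hdis₀ : Disjoint (Submodule.span k (Set.range x₀)) (colZero k n n (n - 1)) := by
    rw [Submodule.disjoint_def]
    intro z hz hzL
    have hz' : z * v₀ ∈ Submodule.span k (Set.range x) := by
      have : Submodule.span k (Set.range x₀) = (Submodule.span k (Set.range x)).map (mulRightLin k v₀) := by
        rw [Submodule.map_span, ← Set.range_comp]; rfl
      rw [this] at hz
      obtain ⟨y, hy, rfl⟩ := hz
      rw [mulRightLin_apply, Matrix.mul_assoc, hv₀v₀, Matrix.mul_one]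
      exact hy
    have h0 := Submodule.disjoint_def.1 hdis _ hz' (hv₀L z hzL)
    have : z = z * v₀ * v₀ := by rw [Matrix.mul_assoc, hv₀v₀, Matrix.mul_one]
    rw [this, h0, Matrix.zero_mul]
  -- the part independent modulo `L_{h+1}`
  obtain ⟨T₁, -, -, hspan, hli⟩ :=
    exists_linearIndepOn_extension (linearIndepOn_empty k d₀) (Set.empty_subset (Set.univ : Set (Fin s)))
  set T₁f : Finset (Fin s) := (Set.toFinite T₁).toFinset with hT₁f
  have hmemT : ∀ l, l ∈ T₁f ↔ l ∈ T₁ := fun l => (Set.toFinite T₁).mem_toFinset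
  have hcoeT : (T₁f : Set (Fin s)) = T₁ := by ext l; simp [hmemT]
  have hT₁ne : T₁f.Nonempty := by
    rw [Finset.nonempty_iff_ne_empty]
    intro hemp
    have hT₁e : T₁ = ∅ := by rw [← hcoeT, hemp]; simp
    have := hspan ⟨l₀, Set.mem_univ _, rfl⟩
    rw [hT₁e, Set.image_empty, Submodule.span_empty] at this
    exact hd₀l₀ (by simpa using this)
  have hs'pos : 0 < T₁f.card := Finset.card_pos.2 hT₁ne
  set s₂ := (T₁fᶜ).card with hs₂
  have hs0 : 0 < s := Fin.pos l₀
  have hcardle : T₁f.card ≤ s := by simpa using Finset.card_le_univ T₁f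
  have hs₂s : s₂ + T₁f.card = s := by
    rw [hs₂, Finset.card_compl, Fintype.card_fin]; omega
  have hs₂lt : s₂ < s := by omega
  -- Step 4: row operations on the first `s+1` rows
  let topW : (Fin n → k) →ₗ[k] (Fin (s + 1) → k) :=
    { toFun := window 0 (s + 1) hs1
      map_add' := fun _ _ => rfl
      map_smul' := fun _ _ => rfl }
  set D' : Submodule k (Fin (s + 1) → k) := (Submodule.span k (d₀ '' T₁)).map topW with hD'
  have hδ : finrank k D' ≤ T₁f.card := by
    refine (Submodule.finrank_map_le _ _).trans ?_
    have : Submodule.span k (d₀ '' T₁) = Submodule.span k (Set.range fun l : T₁f => d₀ l) := by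
      congr 1; ext y; simp [hmemT]
    rw [this]
    have h1 := finrank_range_le_card (R := k) (fun l : T₁f => d₀ l)
    rw [Set.finrank] at h1
    simpa using h1
  obtain ⟨Lδ, hLδ⟩ := exists_linearEquiv_adapted D' (α := finrank k D') rfl
  set A₀ := LinearMap.toMatrix' Lδ.toLinearMap with hA₀
  set A₀' := LinearMap.toMatrix' Lδ.symm.toLinearMap with hA₀'
  set u₀ := blockEmbed n 0 (s + 1) A₀ with hu₀_def
  set u₀' := blockEmbed n 0 (s + 1) A₀' with hu₀'_def
  have hu₀ : u₀ * u₀' = 1 :=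
    blockEmbed_mul_blockEmbed_eq_one 0 (s + 1) hs1 A₀ A₀' (toMatrix'_mul_toMatrix'_symm Lδ)
  have hu₀' : u₀' * u₀ = 1 :=
    blockEmbed_mul_blockEmbed_eq_one 0 (s + 1) hs1 A₀' A₀ (toMatrix'_symm_mul_toMatrix' Lδ)
  have hu₀top : IsTopBlock (s + 1) u₀ := isTopBlock_blockEmbed (s + 1) A₀
  -- the key property: the first `s + 1 - s'` entries of `u₀ d₀ l` vanish
  have hP4 : ∀ l (i : Fin n), (i : ℕ) < s₂ + 1 → (u₀ *ᵥ d₀ l) i = 0 := by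
    intro l i hi
    have hmem : topW (d₀ l) ∈ D' := Submodule.mem_map_of_mem (hspan ⟨l, Set.mem_univ _, rfl⟩)
    have hi' : (i : ℕ) < s + 1 := by omega
    have hii : i = blkEmb 0 (s + 1) hs1 ⟨i, hi'⟩ := Fin.ext (by simp)
    rw [hii, hu₀_def, blockEmbed_mulVec_blk 0 (s + 1) hs1 A₀ (d₀ l) ⟨i, hi'⟩, hA₀,
      LinearMap.toMatrix'_mulVec]
    exact (hLδ _).1 hmem ⟨i, hi'⟩ (by simp only; omega)
  -- the transformed matrices `x' l = u₀ x l v₀`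
  set x' : Fin s → Matrix (Fin n) (Fin n) k := fun l => u₀ * x₀ l with hx'
  have hx'L : ∀ l, x' l ∈ colZero k n n h := fun l => mul_mem_colZero u₀ (hx₀L l)
  set d : Fin s → (Fin n → k) := fun l => colMap k jh (x' l) with hd
  have hdd₀ : ∀ l, d l = u₀ *ᵥ d₀ l := fun l => colMap_mul jh u₀ (x₀ l)
  have hP4' : ∀ l (i : Fin n), (i : ℕ) < s₂ + 1 → x' l i jh = 0 := by
    intro l i hi
    have := hP4 l i hi
    rwa [← hdd₀] at this
  have hu₀inj : Function.Injective u₀.mulVec := mulVec_injective_of_mul_eq_one hu₀'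
  have hli' : LinearIndepOn k d T₁ := by
    have hker : LinearMap.ker u₀.mulVecLin = ⊥ := LinearMap.ker_eq_bot.2 hu₀inj
    have h1 := hli.linearIndependent.map' u₀.mulVecLin hker
    have : (fun l : T₁ => d l) = u₀.mulVecLin ∘ fun l : T₁ => d₀ l := by
      funext l; rw [Function.comp_apply, Matrix.mulVecLin_apply, hdd₀]
    show LinearIndependent k (fun l : T₁ => d l)
    rw [this]; exact h1
  have hspan' : ∀ l, d l ∈ Submodule.span k ((colMap k jh ∘ x') '' T₁) := by
    intro l
    have h1 : u₀.mulVecLin (d₀ l) ∈ (Submodule.span k (d₀ '' T₁)).map u₀.mulVecLin :=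
      Submodule.mem_map_of_mem (hspan ⟨l, Set.mem_univ _, rfl⟩)
    rw [map_span_image] at h1
    have h2 : (u₀.mulVecLin ∘ d₀) = colMap k jh ∘ x' := by
      funext l'
      rw [Function.comp_apply, Function.comp_apply, Matrix.mulVecLin_apply, ← hdd₀]
    rw [h2] at h1
    rw [hdd₀]
    exact h1
  have hdis' : Disjoint (Submodule.span k (Set.range x')) (colZero k n n (n - 1)) := by
    rw [Submodule.disjoint_def]
    intro z hz hzL
    have : Submodule.span k (Set.range x') = (Submodule.span k (Set.range x₀)).map (mulLeftLin k u₀) := by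
      rw [Submodule.map_span, ← Set.range_comp]; rfl
    rw [this] at hz
    obtain ⟨y, hy, rfl⟩ := hz
    rw [mulLeftLin_apply] at hzL ⊢
    have hyL : y ∈ colZero k n n (n - 1) := by
      have := mul_mem_colZero u₀' hzL
      rwa [← Matrix.mul_assoc, hu₀', Matrix.one_mul] at this
    rw [Submodule.disjoint_def.1 hdis₀ y hy hyL, Matrix.mul_zero]
  -- Step 5: the projection onto `L_{h+1}` killing the `x' l`, `l ∈ T₁`
  have hdisj : Disjoint (Submodule.span k (x' '' T₁)) (colZero k n n (h + 1)) := by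
    refine (disjoint_span_image_ker (colMap k jh) x' T₁ hli').mono_right ?_
    intro z hz
    rw [LinearMap.mem_ker]
    funext i
    exact hz i jh (by simp [hjh])
  obtain ⟨p, hpfix, hpkill, hprange⟩ := exists_proj_of_disjoint _ _ hdisj
  have hpkill' : ∀ z ∈ Submodule.span k (x' '' T₁), p z = 0 := hpkill
  have hdecomp : ∀ l, x' l - p (x' l) ∈ Submodule.span k (x' '' T₁) := by
    intro l
    obtain ⟨cl, hcl, hFcl⟩ := exists_mem_span_image_apply_eq (colMap k jh) x' T₁ (hspan' l)
    have hclL : cl ∈ colZero k n n h :=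
      (Submodule.span_le.2 (by rintro _ ⟨a, _, rfl⟩; exact hx'L a)) hcl
    have hdiff : x' l - cl ∈ colZero k n n (h + 1) := by
      refine mem_colZero_succ (by omega) (Submodule.sub_mem _ (hx'L l) hclL) ?_
      rw [map_sub, hFcl, sub_self]
    have : p (x' l) = x' l - cl := by
      have h1 : p (x' l - cl) = x' l - cl := hpfix _ hdiff
      rw [map_sub, hpkill' cl hcl, sub_zero] at h1
      exact h1
    rw [this, sub_sub_cancel]
    exact hcl
  -- Step 6: recurse
  let e₂ := (T₁fᶜ).equivFin
  let x₂ : Fin s₂ → Matrix (Fin n) (Fin n) k := fun i => p (x' (e₂.symm i))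
  have hx₂span : Submodule.span k (Set.range x₂) ≤ Submodule.span k (Set.range x') := by
    rw [Submodule.span_le]
    rintro _ ⟨i, rfl⟩
    have h1 : x' (e₂.symm i) - (x' (e₂.symm i) - p (x' (e₂.symm i))) ∈ Submodule.span k (Set.range x') :=
      Submodule.sub_mem _ (Submodule.subset_span ⟨_, rfl⟩)
        ((Submodule.span_mono (Set.image_subset_range _ _)) (hdecomp _))
    simpa [x₂] using h1
  obtain ⟨u₂, u₂', v₂, v₂', hu₂, hu₂', hv₂, hv₂', hu₂top, hv₂fix, hv₂L, t₂, W₂, ht₂s, hW₂, hW₂mem⟩ :=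
    ih s₂ hs₂lt (h + 1) x₂ (by omega) (fun i => hprange _) (hdis'.mono_left hx₂span)
  -- Steps 7–8: assemble
  set W : ℕ → Submodule k (Matrix (Fin n) (Fin n) k) := fun τ =>
    if τ = 1 then (Submodule.span k (x' '' T₁)).map ((mulLeftLin k u₂).comp (mulRightLin k v₂))
    else W₂ (τ - 1) with hW
  have hW1 : W 1 = (Submodule.span k (x' '' T₁)).map ((mulLeftLin k u₂).comp (mulRightLin k v₂)) := by
    show (if (1 : ℕ) = 1 then _ else _) = _
    rw [if_pos rfl]
  have hWsucc : ∀ τ, 1 ≤ τ → W (τ + 1) = W₂ τ := fun τ hτ => by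
    show (if τ + 1 = 1 then _ else W₂ (τ + 1 - 1)) = W₂ τ
    rw [if_neg (by omega), Nat.add_sub_cancel]
  -- zeros in the first `s₂ + 1` rows of column `h` hold on the whole span
  have hspanP4 : ∀ z ∈ Submodule.span k (x' '' T₁), ∀ i : Fin n, (i : ℕ) < s₂ + 1 → z i jh = 0 := by
    intro z hz i hi
    refine Submodule.span_induction (p := fun z _ => z i jh = 0) ?_ ?_ ?_ ?_ hz
    · rintro _ ⟨a, _, rfl⟩; exact hP4' a i hi
    · rfl
    · intro y y' _ _ hy hy'; simp [Matrix.add_apply, hy, hy']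
    · intro a y _ hy; simp [hy]
  have hspanL : ∀ z ∈ Submodule.span k (x' '' T₁), z ∈ colZero k n n h :=
    fun z hz => (Submodule.span_le.2 (by rintro _ ⟨a, _, rfl⟩; exact hx'L a)) hz
  refine ⟨u₂ * u₀, u₀' * u₂', v₀ * v₂, v₂' * v₀, ?_, ?_, ?_, ?_,
    (hu₂top.mono (by omega)).mul hu₀top, hv₀fix.mul (hv₂fix.mono (Nat.le_succ h)),
    fun z hz => ?_, t₂ + 1, W, by omega, ?_, ?_⟩
  · rw [Matrix.mul_assoc, ← Matrix.mul_assoc u₀, hu₀, Matrix.one_mul, hu₂]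
  · rw [Matrix.mul_assoc, ← Matrix.mul_assoc u₂', hu₂', Matrix.one_mul, hu₀']
  · rw [Matrix.mul_assoc, ← Matrix.mul_assoc v₂, hv₂, Matrix.one_mul, hv₀v₀]
  · rw [Matrix.mul_assoc, ← Matrix.mul_assoc v₀, hv₀v₀, Matrix.one_mul, hv₂']
  · rw [← Matrix.mul_assoc]; exact hv₂L _ (hv₀L z hz)
  · -- the conditions on the `W τ`
    intro τ h1 h2
    rcases Nat.lt_or_ge 1 τ with hτ | hτ
    · obtain ⟨τ', rfl⟩ : ∃ τ', τ = τ' + 1 := ⟨τ - 1, by omega⟩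
      rw [hWsucc τ' (by omega), show h + (τ' + 1) = h + 1 + τ' by omega]
      exact hW₂ τ' (by omega) (by omega)
    · have hτ1 : τ = 1 := by omega
      subst hτ1
      rw [hW1]
      constructor
      · -- `W 1 ⊆ Z_{h+1}`
        rintro _ ⟨z, hz, rfl⟩
        simp only [LinearMap.comp_apply, mulLeftLin_apply, mulRightLin_apply]
        refine ⟨fun i j hj => ?_, fun i j hi hj => ?_⟩
        · have : u₂ * (z * v₂) ∈ colZero k n n h := mul_mem_colZero u₂ (fun i' j' hj' => by
            rw [mul_apply_of_fixesCols hv₂fix z i' j' (by omega)]; exact hspanL z hz i' j' hj')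
          exact this i j (by omega)
        · have hj' : j = jh := Fin.ext (by simp [hjh]; omega)
          subst hj'
          refine topBlock_mul_apply_eq_zero hu₂top (z * v₂) i jh (by omega) fun l hl => ?_
          rw [mul_apply_of_fixesCols hv₂fix z l jh (by simp [hjh])]
          exact hspanP4 z hz l hl
      · -- `W 1 ∩ L_{h+1} = 0`
        rw [Submodule.disjoint_def]
        rintro _ ⟨z, hz, rfl⟩ hzL
        simp only [LinearMap.comp_apply, mulLeftLin_apply, mulRightLin_apply] at hzL ⊢
        have hcol : colMap k jh z = 0 := by
          have h1 : colMap k jh (u₂ * (z * v₂)) = 0 := funext fun i => hzL i jh (by simp [hjh])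
          rw [colMap_mul, colMap_mul_of_fixesCols hv₂fix jh (by simp [hjh]) z] at h1
          exact mulVec_injective_of_mul_eq_one hu₂' (by rw [h1, Matrix.mulVec_zero])
        have hz0 : z = 0 := Submodule.disjoint_def.1 (disjoint_span_image_ker (colMap k jh) x' T₁ hli')
          z hz (LinearMap.mem_ker.2 hcol)
        simp [hz0]
  · -- membership of the `u x_l v`
    intro l
    have hsplit : u₂ * u₀ * x l * (v₀ * v₂) =
        u₂ * ((x' l - p (x' l)) * v₂) + u₂ * (p (x' l) * v₂) := by
      simp only [hx', hx₀]
      rw [← Matrix.mul_add, ← Matrix.add_mul, sub_add_cancel]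
      simp only [Matrix.mul_assoc]
    rw [hsplit]
    refine Submodule.add_mem _ ?_ ?_
    · refine Submodule.mem_iSup_of_mem 1 (Submodule.mem_iSup_of_mem (by simp) ?_)
      rw [hW1]
      exact ⟨_, hdecomp l, by simp⟩
    · by_cases hl : l ∈ T₁f
      · have : p (x' l) = 0 := hpkill' _ (Submodule.subset_span ⟨l, (hmemT l).1 hl, rfl⟩)
        rw [this, Matrix.zero_mul, Matrix.mul_zero]
        exact Submodule.zero_mem _
      · have hlc : l ∈ T₁fᶜ := Finset.mem_compl.2 hl
        have hx₂l : p (x' l) = x₂ (e₂ ⟨l, hlc⟩) := by simp [x₂]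
        have hmem := hW₂mem (e₂ ⟨l, hlc⟩)
        rw [← hx₂l, Matrix.mul_assoc] at hmem
        refine biSup_induction W₂ (motive := fun y => y ∈ ⨆ τ ∈ Finset.Icc 1 (t₂ + 1), W τ) hmem
          (fun τ hτ y hy => ?_) (Submodule.zero_mem _)
          (fun y y' hy hy' => Submodule.add_mem _ hy hy')
        obtain ⟨hτ1, hτ2⟩ := Finset.mem_Icc.1 hτ
        have hτ' : τ + 1 ∈ Finset.Icc 1 (t₂ + 1) := Finset.mem_Icc.2 ⟨by omega, by omega⟩
        refine Submodule.mem_iSup_of_mem (τ + 1) (Submodule.mem_iSup_of_mem hτ' ?_)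
        rw [hWsucc τ hτ1]; exact hy

end Lemma13

end Literature.Computability.AlgebraicComplexity
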